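import Summits.BirchSwinnertonDyer.BirchSwinnertonDyer.Theorems.PrintCf2SplitBadTwoRestrictedSelmerBottomKummerSquare
import Literature.NumberTheory.EllipticCurves.IwasawaCoinvariantsRankProofs
import Literature.NumberTheory.EllipticCurves.AnticyclotomicSignedSelmerLocalOrderProofs
import HarnessLib

/-!
# Crux `PrintCf2.SplitBadTwoRankOneOfFacts` (stmt-BirchSwinnertonDyer-20368), road α, stub S3c — the bottom value of `𝔖_{v̄}(K, M)` with
# CANONICAL Kummer subgroup and CANONICAL local condition at `v̄`: the three factors pinned to the tree's Kummer map and Selmer condition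

Cell `bsd-print-cf2`, width seat `bsd-line-cf2-p1-w7` g2, file 4 of the bottom-value lane (p661732 `…BottomSnake`, p662108
`…BottomKummerSquare`, `…EigenProjector`); `--supports stmt-BirchSwinnertonDyer-20368` (helper, Theses-free). HONEST FRAMING: nothing
here closes a crux or a stub; BSD is not proved by any of this; no summit statement is proved by this seat. No definition, no named fact,
no `sorry`, no kit. beyond-print theorem: no.

WHAT THIS ADDS. In p661732 the second factor `Ш(K)[M]` was `(𝔖_v(K, M) ⊓ loc_{v̄}⁻¹ Q′) ⧸ Q` for ARBITRARY subgroups `Q` («global Kummer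
image») and `Q′ ≤ H¹(⊤ ⊓ D_{v̄}, M)` («local Kummer image»). The tree's local Kummer condition of an elliptic curve does not live in
`H¹(⊤ ⊓ D_{v̄}, ·)` but in the kernel currency `WeierstrassCurve.localKerOver p ⊤ K_{v̄}` (classes of `H¹(⊤, E[p^∞])` dying in
`H¹(Γ_{K_{v̄}}, E(K̄_{v̄}))`, SubgroupSelmer), and its global Kummer map is `WeierstrassCurve.kummerMapPInfty` (SelmerCorankProofs, proved
injective with range `ker(H¹(K, E[p^∞]) → H¹(K, E))`, unconditional by `zsmul_geomPoints_surjective_holds`). So here: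
* §1 (generic `M`): the three-factor identity with an ABSTRACT LOCAL CONDITION `L ≤ H¹(K, M)` at `v̄` containing `ker loc_{v̄}` in place of
  `loc_{v̄}⁻¹ Q′` — `#𝔖_{v̄}(K, M) = #(Q ⊓ ker loc_{v̄}) · #((𝔖_v(K, M) ⊓ L) ⧸ Q) · #loc_v(𝔖_{v̄}(K, M))` for `Q ≤ 𝔖_v(K, M) ⊓ L` with
  `loc_{v̄}(𝔖_v(K, M) ⊓ L) ⊆ loc_{v̄}(Q)` (`natCard_restrictedSelmerBase_eq_three_mul_of_local`, `ord_p` form, finiteness).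
* §2 (the CM summand `M = E[𝔮^∞] = V.endEigenPrimaryTorsion p π r ≤ E[p^∞]`, `ι` the inclusion): the CANONICAL choices
  `L_M := ι_*⁻¹ (V.localKerOver p ⊤ K_{v̄})` (classes of the summand satisfying the CLASSICAL condition at `v̄`) and
  `Q_M := ι_*⁻¹ (res_⊤ (range kummerMapPInfty))` (classes of the summand that are KUMMER classes of `E(K) ⊗ ℚ_p/ℤ_p`), with the two
  inclusions the identity needs PROVED: `ker loc_{v̄} ≤ L_M` (`ker_resOfLe_le_comap_localKerOver`: a class of the summand locally ZERO at
  `v̄` satisfies the classical condition — Greenberg's `awayKer ≤` Kobayashi's Kummer condition `≤ localKerOver`, tree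
  `AcSigned.awayKer_le_localKummerOverOfEmb` + `Kobayashi2003.localKummerOverOfEmb_le_localKerOverOfEmb`) and `Q_M ≤ L_M` at EVERY completion
  (`comap_kummer_le_comap_localKerOver`: Kummer classes are Selmer classes, tree `ker_primaryH1ToH1_le_selmerGroupPInfty` +
  `resSubgroup_top_mem_localKerOver`); whence **`natCard_restrictedSelmerBase_eq_three_mul_summand`**:
  `#𝔖_{v̄}(K, M) = #(Q_M ⊓ ker loc_{v̄}) · #((𝔖_v(K, M) ⊓ L_M) ⧸ Q_M) · #loc_v(𝔖_{v̄}(K, M))` GRANTED the two displayed ARITHMETIC inputs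
  (H1) `Q_M ≤ 𝔖_v(K, M)` — Kummer classes of the summand are locally trivial at `w ∤ p` (`E(K_w) ⊗ ℚ_p/ℤ_p = 0`) and STRICT at `v`
  (`E(K_v) ⊗_𝒪 D_{v̄} = 0`, the CM input) — and (H2) `loc_{v̄}(𝔖_v(K, M) ⊓ L_M) ⊆ loc_{v̄}(Q_M)` — `r = 1` exhaustion (Agboola (6.11),
  `E_{1,𝔭*} = 0`; cf. p662108 `le_of_forall_lt_finite_of_infinite`). The middle factor is now a canonical object: the classes of the summand
  with the classical condition at `v̄`, strict at `v`, trivial away from `p`, modulo Kummer classes — it injects into `Ш(E/K)[p^∞]`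
  (kernel of `H¹(K, M) → H¹(K, E[p^∞]) → H¹(K, E)` is `Q_M` by `range_kummerMapPInfty`), the `M`-part of Ш (LEAD g12 memo T1; -w8 B6 chain
  counts it).

presearch: Agboola 2007 Prop. 6.11 (held) for the shape; Greenberg LNM 1716 §2 for «Kummer condition = 0 away from p»; nothing new claimed.
References: A. Agboola, Compositio 143 (2007) §6 [Agboola2007]; R. Greenberg, LNM 1716 (1999) §2–§4 [GreenbergLNM1716];
S. Kobayashi, Invent. Math. 152 (2003) Def. 1.1 [Kobayashi2003].
-/

noncomputable section

open scoped Classical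

set_option linter.dupNamespace false
set_option autoImplicit false

open NumberField IsDedekindDomain Field
open Literature.NumberTheory.EllipticCurves Literature.NumberTheory.EllipticCurves.GreenbergSelmer
open Literature.NumberTheory.EllipticCurves.Castella2018.AcSelmer
open Literature.NumberTheory.EllipticCurves.Agboola2007
open Literature.NumberTheory.EllipticCurves.ResKernel
open Literature.NumberTheory.GaloisRepresentations

universe u

namespace Summit.BirchSwinnertonDyer.BirchSwinnertonDyer.Theorems.PrintCf2.RestrictedSelmerPair

/-! ## §1. The three factors with an abstract local condition `L` at `v̄` -/

section Local

variable {K : Type u} [Field K] [NumberField K] (M : Type u) [AddCommGroup M]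
  [DistribMulAction (absoluteGaloisGroup K) M] [TopologicalSpace M] [DiscreteTopology M]
  (p : ℕ) (v vbar : HeightOneSpectrum (𝓞 K))
  (L Q : AddSubgroup (subgroupH1 (⊤ : Subgroup (absoluteGaloisGroup K)) M))

/-- **A local condition at `v̄` containing the locally-zero classes cuts the Greenberg-shaped group `𝔖_v(K, M)` back to the doubly-strict
group along `ker loc_{v̄}`**: `(𝔖_v(K, M) ⊓ L) ⊓ ker loc_{v̄} = 𝔖_v(K, M) ⊓ 𝔖_{v̄}(K, M)` whenever `ker loc_{v̄} ≤ L`.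
[cite: Agboola2007, §3 (arXiv p0008:L50–56), §6] -/
theorem restrictedSelmerBase_inf_local_inf_ker_eq (hL : (resOfLe M (inf_le_left : ⊤ ⊓ decomp vbar ≤ ⊤)).ker ≤ L) :
    (restrictedSelmerBase M p v ⊓ L) ⊓ (resOfLe M (inf_le_left : ⊤ ⊓ decomp vbar ≤ ⊤)).ker =
      restrictedSelmerBase M p v ⊓ restrictedSelmerBase M p vbar := by
  rw [restrictedSelmerBase_inf_eq M p vbar v, inf_assoc]
  congr 1
  exact le_antisymm inf_le_right (le_inf hL le_rfl)

/-- **THE THREE FACTORS WITH AN ABSTRACT LOCAL CONDITION.** For every discrete `Γ_K`-module `M`, places `v`, `v̄`, every «local condition at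
`v̄`» `L ≤ H¹(K, M)` containing `ker loc_{v̄}`, and every «Kummer subgroup» `Q ≤ 𝔖_v(K, M) ⊓ L` whose localisation at `v̄` EXHAUSTS that of the
true Selmer group `𝔖_v(K, M) ⊓ L` (`r = 1`):
`#𝔖_{v̄}(K, M) = #(Q ⊓ ker loc_{v̄}) · #((𝔖_v(K, M) ⊓ L) ⧸ Q) · #loc_v(𝔖_{v̄}(K, M))`.
[cite: Agboola2007, Props. 6.10, 6.11 (arXiv p0014:L1–p0015:L12)] -/
theorem natCard_restrictedSelmerBase_eq_three_mul_of_local (hL : (resOfLe M (inf_le_left : ⊤ ⊓ decomp vbar ≤ ⊤)).ker ≤ L)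
    (hQ : Q ≤ restrictedSelmerBase M p v ⊓ L)
    (hcov : (restrictedSelmerBase M p v ⊓ L).map (resOfLe M (inf_le_left : ⊤ ⊓ decomp vbar ≤ ⊤)) ≤
      Q.map (resOfLe M (inf_le_left : ⊤ ⊓ decomp vbar ≤ ⊤))) :
    Nat.card (restrictedSelmerBase M p vbar) =
      Nat.card ↥(Q ⊓ (resOfLe M (inf_le_left : ⊤ ⊓ decomp vbar ≤ ⊤)).ker) *
        Nat.card (↥(restrictedSelmerBase M p v ⊓ L) ⧸ Q.addSubgroupOf (restrictedSelmerBase M p v ⊓ L)) *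
        Nat.card ((resOfLe M (inf_le_left : ⊤ ⊓ decomp v ≤ ⊤)).comp (restrictedSelmerBase M p vbar).subtype).range := by
  rw [card_restrictedSelmerBase_eq M p v vbar, ← restrictedSelmerBase_inf_local_inf_ker_eq M p v vbar L hL,
    natCard_inf_ker_eq_mul_natCard_quotient _ _ Q hQ hcov]

/-- **Finiteness of the three factors** (abstract local condition) when `𝔖_{v̄}(K, M)` is finite. [cite: Agboola2007, Props. 6.5, 6.11] -/
theorem finite_three_of_finite_restrictedSelmerBase_of_local [Finite (restrictedSelmerBase M p vbar)]
    (hL : (resOfLe M (inf_le_left : ⊤ ⊓ decomp vbar ≤ ⊤)).ker ≤ L) (hQ : Q ≤ restrictedSelmerBase M p v ⊓ L)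
    (hcov : (restrictedSelmerBase M p v ⊓ L).map (resOfLe M (inf_le_left : ⊤ ⊓ decomp vbar ≤ ⊤)) ≤
      Q.map (resOfLe M (inf_le_left : ⊤ ⊓ decomp vbar ≤ ⊤))) :
    Finite ↥(Q ⊓ (resOfLe M (inf_le_left : ⊤ ⊓ decomp vbar ≤ ⊤)).ker) ∧
      Finite (↥(restrictedSelmerBase M p v ⊓ L) ⧸ Q.addSubgroupOf (restrictedSelmerBase M p v ⊓ L)) ∧
      Finite ((resOfLe M (inf_le_left : ⊤ ⊓ decomp v ≤ ⊤)).comp (restrictedSelmerBase M p vbar).subtype).range := by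
  have h := natCard_restrictedSelmerBase_eq_three_mul_of_local M p v vbar L Q hL hQ hcov
  have hne : Nat.card (restrictedSelmerBase M p vbar) ≠ 0 := Nat.card_pos.ne'
  rw [h] at hne
  exact ⟨Nat.finite_of_card_ne_zero (left_ne_zero_of_mul (left_ne_zero_of_mul hne)),
    Nat.finite_of_card_ne_zero (right_ne_zero_of_mul (left_ne_zero_of_mul hne)),
    Nat.finite_of_card_ne_zero (right_ne_zero_of_mul hne)⟩

/-- **`ord_p` form with an abstract local condition**: `ord_p #𝔖_{v̄}(K, M) = ord_p #(Q ⊓ ker loc_{v̄}) + ord_p #((𝔖_v ⊓ L) ⧸ Q) + ord_p #loc_v(𝔖_{v̄})`.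
[cite: Agboola2007, Thm. B via Props. 6.10, 6.11, 8.1 (arXiv p0017:L60–75)] -/
theorem padicValNat_card_restrictedSelmerBase_eq_add_three_of_local [Fact p.Prime] [Finite (restrictedSelmerBase M p vbar)]
    (hL : (resOfLe M (inf_le_left : ⊤ ⊓ decomp vbar ≤ ⊤)).ker ≤ L) (hQ : Q ≤ restrictedSelmerBase M p v ⊓ L)
    (hcov : (restrictedSelmerBase M p v ⊓ L).map (resOfLe M (inf_le_left : ⊤ ⊓ decomp vbar ≤ ⊤)) ≤
      Q.map (resOfLe M (inf_le_left : ⊤ ⊓ decomp vbar ≤ ⊤))) :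
    padicValNat p (Nat.card (restrictedSelmerBase M p vbar)) =
      padicValNat p (Nat.card ↥(Q ⊓ (resOfLe M (inf_le_left : ⊤ ⊓ decomp vbar ≤ ⊤)).ker)) +
        padicValNat p (Nat.card (↥(restrictedSelmerBase M p v ⊓ L) ⧸ Q.addSubgroupOf (restrictedSelmerBase M p v ⊓ L))) +
        padicValNat p (Nat.card
          ((resOfLe M (inf_le_left : ⊤ ⊓ decomp v ≤ ⊤)).comp (restrictedSelmerBase M p vbar).subtype).range) := by
  obtain ⟨h1, h2, h3⟩ := finite_three_of_finite_restrictedSelmerBase_of_local M p v vbar L Q hL hQ hcov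
  rw [natCard_restrictedSelmerBase_eq_three_mul_of_local M p v vbar L Q hL hQ hcov,
    padicValNat.mul (mul_ne_zero Nat.card_pos.ne' Nat.card_pos.ne') Nat.card_pos.ne',
    padicValNat.mul Nat.card_pos.ne' Nat.card_pos.ne']

end Local

/-! ## §2. The CM summand: canonical local condition `ι_*⁻¹ localKerOver` and canonical Kummer subgroup `ι_*⁻¹ res_⊤ (range κ)` -/

section Summand

variable {K : Type u} [Field K] [NumberField K] (V : WeierstrassCurve K) [V.IsElliptic] (p : ℕ) [Fact p.Prime]
  (π : V.endRing) (r : ℤ_[p]) (v vbar : HeightOneSpectrum (𝓞 K))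

omit [NumberField K] [V.IsElliptic] in
/-- **Naturality used throughout**: `loc_w (ι_* c) = ι_* (loc_w c)` for the inclusion `ι : E[𝔮^∞] ↪ E[p^∞]` and any `H₁ ≤ ⊤`
(tree `FineSelmerCoefficientMap.resOfLe_comp_resH1Hom_id`). [cite: SerreGaloisCohomology1997, I.§2.4] -/
theorem resOfLe_resH1Hom_subtype {H₁ : Subgroup (absoluteGaloisGroup K)} (hle : H₁ ≤ ⊤)
    (c : subgroupH1 (⊤ : Subgroup (absoluteGaloisGroup K)) ↥(V.endEigenPrimaryTorsion p π r)) :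
    resOfLe (V.geomPrimaryTorsion p) hle
        (resH1Hom (ContinuousMonoidHom.id _) (V.endEigenPrimaryTorsion p π r).subtype (fun _ _ ↦ rfl) c) =
      resH1Hom (ContinuousMonoidHom.id H₁) (V.endEigenPrimaryTorsion p π r).subtype (fun _ _ ↦ rfl)
        (resOfLe ↥(V.endEigenPrimaryTorsion p π r) hle c) := by
  have h := congrArg (fun f ↦ f c) (FineSelmerCoefficientMap.resOfLe_comp_resH1Hom_id hle
    (V.endEigenPrimaryTorsion p π r).subtype (fun _ _ ↦ rfl) (fun _ _ ↦ rfl))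
  simpa only [AddMonoidHom.comp_apply] using h

omit [V.IsElliptic] in
/-- **A class of the summand which is locally ZERO at `v̄` satisfies the classical local condition at `v̄`**:
`ker loc_{v̄} ≤ ι_*⁻¹ (localKerOver p ⊤ K_{v̄})` — its image in `H¹(⊤, E[p^∞])` dies on `⊤ ⊓ D_{v̄}` (naturality), hence lies in Kobayashi's
Kummer condition for `A = 0` and so in the local kernel `H¹(⊤, E[p^∞]) → H¹(Γ_{K_{v̄}}, E(K̄_{v̄}))`.
[cite: GreenbergLNM1716, §2] [cite: Kobayashi2003, Def. 1.1 and §2 p. 4] -/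
theorem ker_resOfLe_le_comap_localKerOver :
    (resOfLe ↥(V.endEigenPrimaryTorsion p π r) (inf_le_left : ⊤ ⊓ decomp vbar ≤ ⊤)).ker ≤
      (V.localKerOver p ⊤ (vbar.adicCompletion K)).comap
        (resH1Hom (ContinuousMonoidHom.id _) (V.endEigenPrimaryTorsion p π r).subtype (fun _ _ ↦ rfl)) := by
  intro c hc
  rw [AddSubgroup.mem_comap, WeierstrassCurve.localKerOver_eq_ofEmb]
  refine Kobayashi2003.localKummerOverOfEmb_le_localKerOverOfEmb ⊥ (AcSigned.awayKer_le_localKummerOverOfEmb V p ⊤ vbar ⊥ ?_)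
  change resOfLe (V.geomPrimaryTorsion p) (inf_le_left : ⊤ ⊓ decomp vbar ≤ ⊤) _ = 0
  have h := resOfLe_resH1Hom_subtype V p π r (inf_le_left : ⊤ ⊓ decomp vbar ≤ ⊤) c
  rw [AddMonoidHom.mem_ker.mp hc, map_zero] at h
  exact h

/-- **Kummer classes of the summand satisfy the classical local condition at EVERY completion**: with `κ = kummerMapPInfty`
(range `= ker(H¹(K, E[p^∞]) → H¹(K, E))` ⊆ `Sel_{p^∞}(E/K)`, tree) and `res_⊤ : H¹(K, ·) → H¹(⊤, ·)`,
`ι_*⁻¹ (res_⊤ (range κ)) ≤ ι_*⁻¹ (localKerOver p ⊤ E)` for every `K`-algebra field `E` (a completion).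
[cite: GreenbergLNM1716, §2] [cite: SilvermanAEC2009, §VIII.2] -/
theorem comap_kummer_le_comap_localKerOver (w : HeightOneSpectrum (𝓞 K)) :
    (((V.kummerMapPInfty p V.zsmul_geomPoints_surjective_holds).range).map
          (resSubgroup ⊤ (V.geomPrimaryTorsion p))).comap
        (resH1Hom (ContinuousMonoidHom.id _) (V.endEigenPrimaryTorsion p π r).subtype (fun _ _ ↦ rfl)) ≤
      (V.localKerOver p ⊤ (w.adicCompletion K)).comap
        (resH1Hom (ContinuousMonoidHom.id _) (V.endEigenPrimaryTorsion p π r).subtype (fun _ _ ↦ rfl)) := by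
  apply AddSubgroup.comap_mono
  rintro _ ⟨x, hx, rfl⟩
  have hsel : x ∈ V.selmerGroupPInfty p := by
    rw [V.range_kummerMapPInfty p] at hx
    exact V.ker_primaryH1ToH1_le_selmerGroupPInfty p hx
  simp only [WeierstrassCurve.selmerGroupPInfty, AddSubgroup.mem_inf, AddSubgroup.mem_iInf] at hsel
  exact V.resSubgroup_top_mem_localKerOver (hsel.1 w)

/-- **Kummer classes of the summand satisfy the classical local condition at the infinite places too.**
[cite: GreenbergLNM1716, §2] -/
theorem comap_kummer_le_comap_localKerOver_infinitePlace (w : InfinitePlace K) :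
    (((V.kummerMapPInfty p V.zsmul_geomPoints_surjective_holds).range).map
          (resSubgroup ⊤ (V.geomPrimaryTorsion p))).comap
        (resH1Hom (ContinuousMonoidHom.id _) (V.endEigenPrimaryTorsion p π r).subtype (fun _ _ ↦ rfl)) ≤
      (V.localKerOver p ⊤ w.Completion).comap
        (resH1Hom (ContinuousMonoidHom.id _) (V.endEigenPrimaryTorsion p π r).subtype (fun _ _ ↦ rfl)) := by
  apply AddSubgroup.comap_mono
  rintro _ ⟨x, hx, rfl⟩
  have hsel : x ∈ V.selmerGroupPInfty p := by
    rw [V.range_kummerMapPInfty p] at hx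
    exact V.ker_primaryH1ToH1_le_selmerGroupPInfty p hx
  simp only [WeierstrassCurve.selmerGroupPInfty, AddSubgroup.mem_inf, AddSubgroup.mem_iInf] at hsel
  exact V.resSubgroup_top_mem_localKerOver (hsel.2 w)

/-- **THE THREE FACTORS FOR THE CM SUMMAND WITH CANONICAL KUMMER SUBGROUP AND CANONICAL CONDITION AT `v̄`.** For `M = E[𝔮^∞] =
V.endEigenPrimaryTorsion p π r`, `L_M := ι_*⁻¹ (localKerOver p ⊤ K_{v̄})` (classical condition at `v̄`) and
`Q_M := ι_*⁻¹ (res_⊤ (range kummerMapPInfty))` (Kummer classes of the summand): GRANTED (H1) `Q_M ≤ 𝔖_v(K, M)` (Kummer classes of the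
summand are trivial away from `p` and strict at `v`) and (H2) `loc_{v̄}(𝔖_v(K, M) ⊓ L_M) ⊆ loc_{v̄}(Q_M)` (`r = 1` exhaustion),
`#𝔖_{v̄}(K, M) = #(Q_M ⊓ ker loc_{v̄}) · #((𝔖_v(K, M) ⊓ L_M) ⧸ Q_M) · #loc_v(𝔖_{v̄}(K, M))` — Agboola's
`|𝔖_{𝔭*}(K, W*)| = |V| · |Ш(K)(𝔭*)| · [Ш_{rel(𝔭)}(K)(𝔭*) : Ш(K)(𝔭*)]` with every group a tree object.
[cite: Agboola2007, Props. 6.10, 6.11 (arXiv p0014:L1–p0015:L12)] [cite: GreenbergLNM1716, §2] -/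
theorem natCard_restrictedSelmerBase_eq_three_mul_summand
    (hQ : (((V.kummerMapPInfty p V.zsmul_geomPoints_surjective_holds).range).map
          (resSubgroup ⊤ (V.geomPrimaryTorsion p))).comap
        (resH1Hom (ContinuousMonoidHom.id _) (V.endEigenPrimaryTorsion p π r).subtype (fun _ _ ↦ rfl)) ≤
      restrictedSelmerBase ↥(V.endEigenPrimaryTorsion p π r) p v)
    (hcov : (restrictedSelmerBase ↥(V.endEigenPrimaryTorsion p π r) p v ⊓
          (V.localKerOver p ⊤ (vbar.adicCompletion K)).comap
            (resH1Hom (ContinuousMonoidHom.id _) (V.endEigenPrimaryTorsion p π r).subtype (fun _ _ ↦ rfl))).map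
          (resOfLe ↥(V.endEigenPrimaryTorsion p π r) (inf_le_left : ⊤ ⊓ decomp vbar ≤ ⊤)) ≤
      ((((V.kummerMapPInfty p V.zsmul_geomPoints_surjective_holds).range).map
          (resSubgroup ⊤ (V.geomPrimaryTorsion p))).comap
        (resH1Hom (ContinuousMonoidHom.id _) (V.endEigenPrimaryTorsion p π r).subtype (fun _ _ ↦ rfl))).map
          (resOfLe ↥(V.endEigenPrimaryTorsion p π r) (inf_le_left : ⊤ ⊓ decomp vbar ≤ ⊤))) :
    Nat.card (restrictedSelmerBase ↥(V.endEigenPrimaryTorsion p π r) p vbar) =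
      Nat.card ↥((((V.kummerMapPInfty p V.zsmul_geomPoints_surjective_holds).range).map
            (resSubgroup ⊤ (V.geomPrimaryTorsion p))).comap
          (resH1Hom (ContinuousMonoidHom.id _) (V.endEigenPrimaryTorsion p π r).subtype (fun _ _ ↦ rfl)) ⊓
          (resOfLe ↥(V.endEigenPrimaryTorsion p π r) (inf_le_left : ⊤ ⊓ decomp vbar ≤ ⊤)).ker) *
        Nat.card (↥(restrictedSelmerBase ↥(V.endEigenPrimaryTorsion p π r) p v ⊓
            (V.localKerOver p ⊤ (vbar.adicCompletion K)).comap
              (resH1Hom (ContinuousMonoidHom.id _) (V.endEigenPrimaryTorsion p π r).subtype (fun _ _ ↦ rfl))) ⧸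
          ((((V.kummerMapPInfty p V.zsmul_geomPoints_surjective_holds).range).map
              (resSubgroup ⊤ (V.geomPrimaryTorsion p))).comap
            (resH1Hom (ContinuousMonoidHom.id _) (V.endEigenPrimaryTorsion p π r).subtype (fun _ _ ↦ rfl))).addSubgroupOf
            (restrictedSelmerBase ↥(V.endEigenPrimaryTorsion p π r) p v ⊓
              (V.localKerOver p ⊤ (vbar.adicCompletion K)).comap
                (resH1Hom (ContinuousMonoidHom.id _) (V.endEigenPrimaryTorsion p π r).subtype (fun _ _ ↦ rfl)))) *
        Nat.card ((resOfLe ↥(V.endEigenPrimaryTorsion p π r) (inf_le_left : ⊤ ⊓ decomp v ≤ ⊤)).comp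
          (restrictedSelmerBase ↥(V.endEigenPrimaryTorsion p π r) p vbar).subtype).range :=
  natCard_restrictedSelmerBase_eq_three_mul_of_local _ p v vbar _ _ (ker_resOfLe_le_comap_localKerOver V p π r vbar)
    (le_inf hQ (comap_kummer_le_comap_localKerOver V p π r vbar)) hcov

end Summand

end Summit.BirchSwinnertonDyer.BirchSwinnertonDyer.Theorems.PrintCf2.RestrictedSelmerPair

end
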